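import Mathlib
import Literature.RingTheory.PowerSeries.LaurentSeriesConstants
import HarnessLib

/-!
# `LogPrimitiveNL` (stmt-KontsevichZagierPeriods-2836), line `ax-schanuel-germs`, stub `stub_structure` —
part C: the formal differential field `(ℝ⸨X⸩, d/dX)` and its subfield of algebraic elements

Bookkeeping that lets the abstract log-linear theorem (stub `stub_abstractLogLinear`, stated for a
field with a `ℤ`-derivation and a subfield) be applied to `L = ℝ⸨X⸩`, `D = d/dX`
(`LaurentSeries.derivative`, packaged as a derivation by the tree's
`Literature.RingTheory.PowerSeries.exists_derivation_eq_derivative`), `F` = the elements algebraic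
over `ℝ(X)` (Mathlib's `algebraicClosure (RatFunc ℝ) ℝ⸨X⸩`): characteristic zero, constants are
real (tree `derivative_eq_zero_iff`) hence algebraic, and the conversion of the Rosenlicht property
from real-constant form (stub `stub_rosenlichtProperty`) to the abstract form. [folklore]
-/

noncomputable section

open scoped LaurentSeries RatFunc Polynomial

namespace Summit.KontsevichZagierPeriods.LiouvilleUnfolding.LogPrimitiveNL.AxSchanuelGerms

-- `Derivation ℤ ℝ⸨X⸩ ℝ⸨X⸩` is meant for the canonical `ℤ`-algebra structure of the ring `ℝ⸨X⸩`
-- (the one a statement `∀ (L : Type) [Field L], … Derivation ℤ L L …` specialises to), not for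
-- `HahnSeries.powerSeriesAlgebra`.
attribute [local instance 10000] Ring.toIntAlgebra

/-- The algebra map `ℝ → ℝ⸨X⸩` is injective. [folklore] -/
theorem algebraMap_laurentSeries_injective : Function.Injective (algebraMap ℝ ℝ⸨X⸩) := by
  intro a b h
  rw [Literature.RingTheory.PowerSeries.algebraMap_laurentSeries_apply,
    Literature.RingTheory.PowerSeries.algebraMap_laurentSeries_apply] at h
  exact HahnSeries.C_injective h

/-- `ℝ⸨X⸩` has characteristic zero. [folklore] -/
theorem charZero_laurentSeries : CharZero ℝ⸨X⸩ :=
  charZero_of_injective_algebraMap algebraMap_laurentSeries_injective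

/-- `d/dX` as a `ℤ`-derivation of `ℝ⸨X⸩`. [folklore] -/
theorem exists_intDerivation_eq_derivative :
    ∃ D : @Derivation ℤ ℝ⸨X⸩ ℝ⸨X⸩ _ _ _ (Ring.toIntAlgebra ℝ⸨X⸩) _ _,
      ∀ f, D f = LaurentSeries.derivative ℝ f := by
  obtain ⟨d, hd⟩ := Literature.RingTheory.PowerSeries.exists_derivation_eq_derivative (R := ℝ)
  let D : Derivation ℤ ℝ⸨X⸩ ℝ⸨X⸩ :=
    { toFun := d
      map_add' := map_add d
      map_smul' := fun n x => by
        have hn : d (n : ℝ⸨X⸩) = 0 := by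
          rw [show ((n : ℝ⸨X⸩)) = algebraMap ℝ ℝ⸨X⸩ (n : ℝ) by simp, d.map_algebraMap]
        rw [RingHom.id_apply, Algebra.smul_def, zsmul_eq_mul, eq_intCast, d.leibniz, smul_eq_mul,
          smul_eq_mul, hn, mul_zero, add_zero]
      map_one_eq_zero' := d.map_one_eq_zero
      leibniz' := fun a b => d.leibniz a b }
  exact ⟨D, fun f => hd f⟩

/-- Real constants of `ℝ⸨X⸩` are algebraic over `ℝ(X)`. [folklore] -/
theorem isAlgebraic_ratFunc_C (r : ℝ) : IsAlgebraic (RatFunc ℝ) (HahnSeries.C r : ℝ⸨X⸩) := by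
  have h : (HahnSeries.C r : ℝ⸨X⸩) =
      algebraMap (RatFunc ℝ) ℝ⸨X⸩ ((Polynomial.C r : ℝ[X]) : RatFunc ℝ) := by
    rw [← RatFunc.coe_coe, Polynomial.coe_C, HahnSeries.ofPowerSeries_C]
  rw [h]
  exact isAlgebraic_algebraMap _

/-- Constants of `d/dX` are real constants, hence algebraic over `ℝ(X)`. [folklore] -/
theorem isAlgebraic_of_derivative_eq_zero {f : ℝ⸨X⸩} (hf : LaurentSeries.derivative ℝ f = 0) :
    IsAlgebraic (RatFunc ℝ) f := by
  rw [(Literature.RingTheory.PowerSeries.derivative_eq_zero_iff f).1 hf]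
  exact isAlgebraic_ratFunc_C _

/-- Membership in the subfield of algebraic elements. [folklore] -/
theorem mem_algebraicSubfield_iff {f : ℝ⸨X⸩} :
    f ∈ (algebraicClosure (RatFunc ℝ) ℝ⸨X⸩).toSubfield ↔ IsAlgebraic (RatFunc ℝ) f :=
  mem_algebraicClosure_iff

/-- Constants of `d/dX`: the family of constant coefficients reproduces a family of constants, and
inherits `ℚ`-linear independence. [folklore] -/
theorem constants_eq_C_coeff [CharZero ℝ⸨X⸩] {m : ℕ} {c : Fin m → ℝ⸨X⸩}
    (hc : ∀ j, LaurentSeries.derivative ℝ (c j) = 0) (hli : LinearIndependent ℚ c) :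
    (∀ j, c j = HahnSeries.C ((c j).coeff 0)) ∧
      LinearIndependent ℚ (fun j => (c j).coeff 0) := by
  have hcj : ∀ j, c j = HahnSeries.C ((c j).coeff 0) := fun j =>
    (Literature.RingTheory.PowerSeries.derivative_eq_zero_iff (c j)).1 (hc j)
  refine ⟨hcj, ?_⟩
  -- `c = C ∘ e` with `C` additive, hence `ℚ`-linear
  let Cq : ℝ →ₗ[ℚ] ℝ⸨X⸩ := (HahnSeries.C : ℝ →+* ℝ⸨X⸩).toAddMonoidHom.toRatLinearMap
  have hcomp : c = Cq ∘ fun j => (c j).coeff 0 := by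
    funext j
    exact hcj j
  rw [hcomp] at hli
  exact LinearIndependent.of_comp Cq hli

/-- **Rosenlicht property, abstract form.** From the real-constant form (stub
`stub_rosenlichtProperty`, taken here as a hypothesis) to the form consumed by the abstract
log-linear theorem: for any `ℤ`-derivation `D` agreeing with `d/dX`, constants `cⱼ` (`D cⱼ = 0`)
`ℚ`-independent, `uⱼ ≠ 0` and `v` algebraic over `ℝ(X)`, `Σ cⱼ D uⱼ/uⱼ + D v = 0 ⇒ D uⱼ = 0`.
[folklore] -/
theorem rosenlicht_abstract_of_real [CharZero ℝ⸨X⸩]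
    (hRP : ∀ (m : ℕ) (e : Fin m → ℝ) (u : Fin m → ℝ⸨X⸩) (v : ℝ⸨X⸩), LinearIndependent ℚ e →
      (∀ j, IsAlgebraic (RatFunc ℝ) (u j)) → (∀ j, u j ≠ 0) → IsAlgebraic (RatFunc ℝ) v →
      (∑ j, HahnSeries.C (e j) * ((u j)⁻¹ * LaurentSeries.derivative ℝ (u j))) +
          LaurentSeries.derivative ℝ v = 0 →
        ∀ j, LaurentSeries.derivative ℝ (u j) = 0)
    (D : Derivation ℤ ℝ⸨X⸩ ℝ⸨X⸩) (hD : ∀ f, D f = LaurentSeries.derivative ℝ f) :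
    ∀ (m : ℕ) (c u : Fin m → ℝ⸨X⸩) (v : ℝ⸨X⸩), (∀ j, D (c j) = 0) → LinearIndependent ℚ c →
      (∀ j, u j ∈ (algebraicClosure (RatFunc ℝ) ℝ⸨X⸩).toSubfield) → (∀ j, u j ≠ 0) →
      v ∈ (algebraicClosure (RatFunc ℝ) ℝ⸨X⸩).toSubfield →
      (∑ j, c j * ((u j)⁻¹ * D (u j))) + D v = 0 → ∀ j, D (u j) = 0 := by
  intro m c u v hc hli hu hu0 hv hrel j
  have hc' : ∀ j, LaurentSeries.derivative ℝ (c j) = 0 := fun j => by rw [← hD]; exact hc j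
  obtain ⟨hcj, hli'⟩ := constants_eq_C_coeff hc' hli
  rw [hD]
  refine hRP m (fun j => (c j).coeff 0) u v hli' (fun j => mem_algebraicSubfield_iff.1 (hu j)) hu0
    (mem_algebraicSubfield_iff.1 hv) ?_ j
  have : (∑ j, c j * ((u j)⁻¹ * D (u j))) + D v =
      (∑ j, HahnSeries.C ((c j).coeff 0) * ((u j)⁻¹ * LaurentSeries.derivative ℝ (u j))) +
        LaurentSeries.derivative ℝ v := by
    rw [hD]
    congr 1
    exact Finset.sum_congr rfl fun j _ => by rw [← hcj j, hD]
  rw [← this]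
  exact hrel

/-- `D`-stability of the algebraic elements, abstract form (from stub `stub_rosenlichtProperty`'s
first conjunct, taken as a hypothesis). [folklore] -/
theorem derivation_mem_algebraicSubfield
    (hst : ∀ x : ℝ⸨X⸩, IsAlgebraic (RatFunc ℝ) x → IsAlgebraic (RatFunc ℝ) (LaurentSeries.derivative ℝ x))
    (D : Derivation ℤ ℝ⸨X⸩ ℝ⸨X⸩) (hD : ∀ f, D f = LaurentSeries.derivative ℝ f) :
    ∀ x ∈ (algebraicClosure (RatFunc ℝ) ℝ⸨X⸩).toSubfield,
      D x ∈ (algebraicClosure (RatFunc ℝ) ℝ⸨X⸩).toSubfield := by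
  intro x hx
  rw [mem_algebraicSubfield_iff] at hx ⊢
  rw [hD]
  exact hst x hx

/-- Constants of `D` lie in the subfield of algebraic elements. [folklore] -/
theorem mem_algebraicSubfield_of_derivation_eq_zero (D : Derivation ℤ ℝ⸨X⸩ ℝ⸨X⸩)
    (hD : ∀ f, D f = LaurentSeries.derivative ℝ f) :
    ∀ x : ℝ⸨X⸩, D x = 0 → x ∈ (algebraicClosure (RatFunc ℝ) ℝ⸨X⸩).toSubfield := by
  intro x hx
  rw [hD] at hx
  exact mem_algebraicSubfield_iff.2 (isAlgebraic_of_derivative_eq_zero hx)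

/-- **Registered ∀-form** of `rosenlicht_abstract_of_real` (helper of `stub_structure`, line
`ax-schanuel-germs`): the Rosenlicht property of the algebraic elements of `(ℝ⸨X⸩, d/dX)` in
real-constant form implies its abstract form for every `ℤ`-derivation agreeing with `d/dX`.
[folklore] -/
theorem structure_formalRosenlicht : ∀ [CharZero ℝ⸨X⸩],
    (∀ (m : ℕ) (e : Fin m → ℝ) (u : Fin m → ℝ⸨X⸩) (v : ℝ⸨X⸩), LinearIndependent ℚ e →
      (∀ j, IsAlgebraic (RatFunc ℝ) (u j)) → (∀ j, u j ≠ 0) → IsAlgebraic (RatFunc ℝ) v →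
      (∑ j, HahnSeries.C (e j) * ((u j)⁻¹ * LaurentSeries.derivative ℝ (u j))) +
          LaurentSeries.derivative ℝ v = 0 →
        ∀ j, LaurentSeries.derivative ℝ (u j) = 0) →
    ∀ (D : @Derivation ℤ ℝ⸨X⸩ ℝ⸨X⸩ _ _ _ (Ring.toIntAlgebra ℝ⸨X⸩) _ _),
    (∀ f, D f = LaurentSeries.derivative ℝ f) →
    ∀ (m : ℕ) (c u : Fin m → ℝ⸨X⸩) (v : ℝ⸨X⸩), (∀ j, D (c j) = 0) → LinearIndependent ℚ c →
      (∀ j, u j ∈ (algebraicClosure (RatFunc ℝ) ℝ⸨X⸩).toSubfield) → (∀ j, u j ≠ 0) →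
      v ∈ (algebraicClosure (RatFunc ℝ) ℝ⸨X⸩).toSubfield →
      (∑ j, c j * ((u j)⁻¹ * D (u j))) + D v = 0 → ∀ j, D (u j) = 0 :=
  fun hRP D hD => rosenlicht_abstract_of_real hRP D hD

end Summit.KontsevichZagierPeriods.LiouvilleUnfolding.LogPrimitiveNL.AxSchanuelGerms

end
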